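import Literature.NumberTheory.Automorphic.ShimuraCurveMapDegreeProofs
import HarnessLib

/-!
# Frey's identity `∫⁻_F |s|² y² dμ = d · covol(Λ)` for a period-lattice form with a degree, on an
# ARBITRARY `Γ ≤ GL₂(ℝ)` — generic port of the tree's `Summit.ABC.….PeriodForm.lintegral_normSq_eq`

Seat `bsd-stepL-tam3-p1` g30 (LEAD of crux 24801 `CartanOnePlaceDegreeLawAtThree`; `--supports` 24801).
The ABC-side file `Summits/ABC/ABC/Theorems/RibetTakahashiSplitManyPrimeValuationProductStubPeriodFormDegree.lean`
(crux line `jl-zero-cycle-height`) proves Frey's identity for `X.Gamma` of a `ShimuraCurveData`; its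
proof uses nothing about the datum beyond the subgroup `X.Gamma ≤ GL₂(ℝ)`. This file is that proof
with `X.Gamma` replaced by an arbitrary `Γ : Subgroup (GL (Fin 2) ℝ)` (verbatim otherwise, adapted from
the ABC file), so that it applies to the Cartan-level groups `X.Gamma` of a `CartanLevelCurveData`
(input (AREA) of the `petarea` cut of the print conjunct (PET) of crux 24801):

`lintegral_normSq_eq : ∫⁻_F ‖s‖² y² dμ = d · covol(Λ_L)` for a fundamental domain `F` of `Γ`, a non-zero
`s ∈ S₂(Γ)` with periods in `Λ_L`, and `d ≥ 1` such that all but finitely many classes `c ∈ ℂ/Λ_L` have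
exactly `d` orbits `Γτ` with `∫_{τ₀}^τ s ≡ c`.
Nothing about degrees of any curve is asserted; BSD is proved for no curve.
[cite: Zagier1985, §1 eq. (3)] [cite: PastenShimura2024, §16 (EqFreyQuaternionic)]
-/

set_option linter.dupNamespace false

noncomputable section

open scoped MatrixGroups ModularForm Topology ENNReal NNReal
open MeasureTheory Filter Set Function
open UpperHalfPlane hiding I

namespace Summit.BirchSwinnertonDyer.BirchSwinnertonDyer.Theorems.CartanCover.PeriodForm

open Literature.NumberTheory.Automorphic
open Literature.NumberTheory.EllipticCurves.ModularForms
  (det_restrictScalars_toSpanSingleton encard_iUnion_of_pairwise_disjoint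
    volume_setOf_exists_sub_mem_eq_zero countable_setOf_cuspForm_eq_zero
    lintegral_eq_mul_covolume_of_tsum_eq lintegral_domain_eq_lintegral_image
    volume_image_coe_eq_zero exists_injOn_and_nhds_le_map)

variable {Γ : Subgroup (GL (Fin 2) ℝ)}

section Local

variable (s : CuspForm Γ 2) (τ₀ : ℍ)

/-- **`Ψ(γτ) − Ψ(τ) ∈ Λ_L` for `γ ∈ Γ`** when the periods of `s` lie in `Λ_L`:
`Ψ(γτ) − Ψ(τ) = ∫_τ^{γτ} s` (additivity of the segment integral). [folklore] -/
theorem segmentIntegral_smul_sub_mem {L : PeriodPair}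
    (hper : HasPeriodsIn Γ s (L.lattice : Set ℂ)) {γ : GL (Fin 2) ℝ} (hγ : γ ∈ Γ)
    (τ : ℍ) : segmentIntegral s τ₀ (γ • τ) - segmentIntegral s τ₀ τ ∈ L.lattice := by
  rw [segmentIntegral_sub_segmentIntegral]
  exact hper γ hγ τ

/-- `Ψ ∘ ofComplex` is real-differentiable at every point of (the image in `ℂ` of) a subset of
`ℍ`, with derivative multiplication by `Ψ'(τ) = s(τ)`. [folklore] -/
theorem hasFDerivWithinAt_segmentIntegral (S : Set ℍ) :
    ∀ x ∈ ((↑) : ℍ → ℂ) '' S, HasFDerivWithinAt (segmentIntegral s τ₀ ∘ ofComplex)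
      ((ContinuousLinearMap.toSpanSingleton ℂ (s (ofComplex x))).restrictScalars ℝ)
      (((↑) : ℍ → ℂ) '' S) x := by
  rintro _ ⟨τ, -, rfl⟩
  exact ((hasDerivAt_segmentIntegral s τ₀ τ.im_pos).hasFDerivAt.restrictScalars
    ℝ).hasFDerivWithinAt

/-- **Local injectivity of `Ψ` off the zeros of `s`** (inverse function theorem on `ℍ`;
`Ψ' = s`). [folklore] -/
theorem exists_injOn_nhdsWithin_segmentIntegral {S : Set ℍ} (hS : ∀ τ ∈ S, s τ ≠ 0) :
    ∀ x ∈ ((↑) : ℍ → ℂ) '' S, ∃ V ∈ 𝓝[((↑) : ℍ → ℂ) '' S] x,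
      InjOn (segmentIntegral s τ₀ ∘ ofComplex) V := by
  rintro _ ⟨τ, hτ, rfl⟩
  have hne : s (ofComplex (τ : ℂ)) ≠ 0 := by
    rw [ofComplex_apply]
    exact hS τ hτ
  obtain ⟨⟨V, hV, hVinj⟩, -⟩ := exists_injOn_and_nhds_le_map
    (differentiableOn_segmentIntegral s τ₀)
    (hasDerivAt_segmentIntegral s τ₀ τ.im_pos) hne
  refine ⟨((↑) : ℍ → ℂ) '' V,
    mem_nhdsWithin_of_mem_nhds (isOpenEmbedding_coe.image_mem_nhds.mpr hV), ?_⟩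
  rintro _ ⟨σ, hσ, rfl⟩ _ ⟨σ', hσ', rfl⟩ h
  simp only [Function.comp_apply, ofComplex_apply] at h
  rw [hVinj hσ hσ' h]

end Local

section AreaStep

variable (s : CuspForm Γ 2) (τ₀ : ℍ) {F : Set ℍ}

/-- The image in `ℂ` of `U = F ∩ {s ≠ 0}` is measurable. [folklore] -/
theorem measurableSet_image_inter (hF : IsHypFundamentalDomain Γ F) :
    MeasurableSet (((↑) : ℍ → ℂ) '' (F ∩ {τ | s τ ≠ 0})) :=
  measurableEmbedding_coe.measurableSet_image.mpr
    (hF.measurableSet.inter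
      (isOpen_ne_fun (ModularFormClass.continuous s) continuous_const).measurableSet)

/-- The multiplicity function `y ↦ #{z ∈ U : Ψ(z) = y}` is measurable. [folklore] -/
theorem measurable_encard_fiber (hF : IsHypFundamentalDomain Γ F) :
    Measurable fun y : ℂ ↦ (((segmentIntegral s τ₀ ∘ ofComplex) ⁻¹' {y} ∩
      ((↑) : ℍ → ℂ) '' (F ∩ {τ | s τ ≠ 0})).encard : ℝ≥0∞) :=
  Literature.Analysis.Calculus.measurable_encard_preimage_inter
    (measurableSet_image_inter s hF) (hasFDerivWithinAt_segmentIntegral s τ₀ _)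
    (exists_injOn_nhdsWithin_segmentIntegral s τ₀ fun _ h ↦ h.2)

/-- **The area formula applied to `Ψ` on `U = F ∩ {s ≠ 0}`**:
`∫_U |s|² dx dy = ∫_ℂ #{z ∈ U : Ψ(z) = y} dy` (Evans–Gariepy Thm. 3.8 in the locally injective
case; the real Jacobian of `Ψ` is `|Ψ'|² = |s|²`). [folklore] -/
theorem lintegral_eq_lintegral_encard (hF : IsHypFundamentalDomain Γ F) :
    ∫⁻ z in ((↑) : ℍ → ℂ) '' (F ∩ {τ | s τ ≠ 0}), ENNReal.ofReal (‖s (ofComplex z)‖ ^ 2) =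
      ∫⁻ y, (((segmentIntegral s τ₀ ∘ ofComplex) ⁻¹' {y} ∩
        ((↑) : ℍ → ℂ) '' (F ∩ {τ | s τ ≠ 0})).encard : ℝ≥0∞) := by
  rw [← Literature.Analysis.Calculus.lintegral_abs_det_fderiv_eq_lintegral_encard
    volume (measurableSet_image_inter s hF) (hasFDerivWithinAt_segmentIntegral s τ₀ _)
    (exists_injOn_nhdsWithin_segmentIntegral s τ₀ fun _ h ↦ h.2)]
  refine setLIntegral_congr_fun (measurableSet_image_inter s hF) ?_
  rintro _ ⟨τ, -, rfl⟩
  dsimp only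
  rw [det_restrictScalars_toSpanSingleton, abs_of_nonneg (sq_nonneg _)]

end AreaStep

section Counting

variable (s : CuspForm Γ 2) (τ₀ : ℍ) {L : PeriodPair} {F : Set ℍ}

/-- **Orbits versus points of the domain.** If the fibre `{Γτ : Ψ(τ) ≡ w}` has `d ≥ 1` orbits
and each of its points lying in `F` is the only point of its orbit in `F`, then the fibre meets `F`
in exactly `d` points (every orbit meets `F`, `IsHypFundamentalDomain.covers`, and
`Ψ(γτ) ≡ Ψ(τ)`). [folklore] -/
theorem encard_fiber_inter_eq (hF : IsHypFundamentalDomain Γ F)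
    (hper : HasPeriodsIn Γ s (L.lattice : Set ℂ)) {w : ℂ} {d : ℕ} (hd : 0 < d)
    (hdeg : Nat.card {y : MulAction.orbitRel.Quotient Γ ℍ // ∃ τ : ℍ,
      (Quotient.mk _ τ : MulAction.orbitRel.Quotient Γ ℍ) = y ∧
        segmentIntegral s τ₀ τ - w ∈ L.lattice} = d)
    (huniq : ∀ τ ∈ F, segmentIntegral s τ₀ τ - w ∈ L.lattice →
      ∀ γ ∈ Γ, γ • τ ∈ F → γ • τ = τ) :
    ({τ : ℍ | τ ∈ F ∧ segmentIntegral s τ₀ τ - w ∈ L.lattice}.encard : ℝ≥0∞) = d := by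
  set A : Set ℍ := {τ : ℍ | τ ∈ F ∧ segmentIntegral s τ₀ τ - w ∈ L.lattice} with hA
  set T := {y : MulAction.orbitRel.Quotient Γ ℍ // ∃ τ : ℍ,
      (Quotient.mk _ τ : MulAction.orbitRel.Quotient Γ ℍ) = y ∧
        segmentIntegral s τ₀ τ - w ∈ L.lattice} with hT
  let e : ↥A → T := fun τ ↦ ⟨Quotient.mk _ (τ : ℍ), τ, rfl, τ.2.2⟩
  have hinj : Injective e := by
    rintro ⟨τ, hτF, hτΛ⟩ ⟨τ', hτF', hτΛ'⟩ h
    have h' : (Quotient.mk _ τ : MulAction.orbitRel.Quotient Γ ℍ) = Quotient.mk _ τ' :=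
      congrArg Subtype.val h
    obtain ⟨γ, hγ, rfl⟩ := (orbitRel_mk_eq_mk_iff τ τ').mp h'
    exact Subtype.ext (huniq τ' hτF' hτΛ' γ hγ hτF)
  have hsurj : Surjective e := by
    rintro ⟨y, τ₁, hy, hΛ⟩
    obtain ⟨γ, hγ, hγF⟩ := hF.covers τ₁
    have hA₁ : γ • τ₁ ∈ A := by
      refine ⟨hγF, ?_⟩
      have := L.lattice.add_mem (segmentIntegral_smul_sub_mem s τ₀ hper hγ τ₁) hΛ
      rwa [sub_add_sub_cancel] at this
    refine ⟨⟨γ • τ₁, hA₁⟩, Subtype.ext ?_⟩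
    change (Quotient.mk _ (γ • τ₁) : MulAction.orbitRel.Quotient Γ ℍ) = y
    rw [← hy]
    exact (orbitRel_mk_eq_mk_iff _ _).mpr ⟨γ, hγ, rfl⟩
  have hcard : Nat.card ↥A = d :=
    (Nat.card_congr (Equiv.ofBijective e ⟨hinj, hsurj⟩)).trans hdeg
  have hfin : A.Finite := by
    have : Finite ↥A := Nat.finite_of_card_ne_zero (hcard ▸ hd.ne')
    exact Set.toFinite A
  rw [← hfin.cast_ncard_eq, ENat.toENNReal_coe, ← Nat.card_coe_set_eq, hcard]

/-- The set of `w ∈ ℂ` whose class modulo `Λ_L` lies in a finite set of classes is countable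
(finitely many cosets of the countable lattice). [folklore] -/
theorem countable_setOf_coe_mem {E : Set (ℂ ⧸ L.lattice.toAddSubgroup)} (hE : E.Finite) :
    {w : ℂ | ((w : ℂ) : ℂ ⧸ L.lattice.toAddSubgroup) ∈ E}.Countable := by
  classical
  haveI : Countable L.lattice := Countable.of_equiv _ L.latticeEquivProd.toEquiv.symm
  have hrep : ∀ c : ℂ ⧸ L.lattice.toAddSubgroup, ∃ w : ℂ, (w : ℂ ⧸ L.lattice.toAddSubgroup) = c :=
    QuotientAddGroup.mk_surjective
  choose rep hrep using hrep
  refine Set.Countable.mono (fun w hw ↦ ?_)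
    (hE.countable.biUnion fun c _ ↦ Set.countable_range (fun l : L.lattice ↦ rep c + (l : ℂ)))
  have hl : w - rep ((w : ℂ) : ℂ ⧸ L.lattice.toAddSubgroup) ∈ L.lattice := by
    rw [← Submodule.mem_toAddSubgroup, ← QuotientAddGroup.eq_iff_sub_mem, hrep]
  exact mem_iUnion₂.mpr ⟨_, hw, ⟨w - rep _, hl⟩, add_sub_cancel _ _⟩

/-- **The periodised multiplicity is `d` almost everywhere**: if all but finitely many classes
`c ∈ ℂ/Λ_L` have exactly `d ≥ 1` orbits `Γτ` with `Ψ(τ) ≡ c`, then for a.e. `w ∈ ℂ` the points `z` of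
`U = F ∩ {s ≠ 0}` with `Ψ(z) ≡ w (mod Λ_L)` number exactly `d` (off three null sets: cosets through
the exceptional classes; `Λ_L`-translates of `Ψ` of the null non-uniqueness set of `F`; of `Ψ` of the
countable zero set of `s`). [folklore] -/
theorem ae_tsum_encard_fiber_eq (hF : IsHypFundamentalDomain Γ F) (hs : (⇑s : ℍ → ℂ) ≠ 0)
    (hper : HasPeriodsIn Γ s (L.lattice : Set ℂ)) {d : ℕ} (hd : 0 < d)
    (hfin : {c : ℂ ⧸ L.lattice.toAddSubgroup |
        Nat.card {y : MulAction.orbitRel.Quotient Γ ℍ // ∃ τ : ℍ,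
          (Quotient.mk _ τ : MulAction.orbitRel.Quotient Γ ℍ) = y ∧
            ((segmentIntegral s τ₀ τ : ℂ) : ℂ ⧸ L.lattice.toAddSubgroup) = c} ≠ d}.Finite) :
    ∀ᵐ w : ℂ, ∑' l : L.lattice,
      (((segmentIntegral s τ₀ ∘ ofComplex) ⁻¹' {(l : ℂ) + w} ∩
        ((↑) : ℍ → ℂ) '' (F ∩ {τ | s τ ≠ 0})).encard : ℝ≥0∞) = d := by
  classical
  haveI : Countable L.lattice := Countable.of_equiv _ L.latticeEquivProd.toEquiv.symm
  have hΛc : (L.lattice : Set ℂ).Countable := Set.countable_coe_iff.mp inferInstance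
  set Ψ : ℍ → ℂ := segmentIntegral s τ₀ with hΨ
  set E := {c : ℂ ⧸ L.lattice.toAddSubgroup |
        Nat.card {y : MulAction.orbitRel.Quotient Γ ℍ // ∃ τ : ℍ,
          (Quotient.mk _ τ : MulAction.orbitRel.Quotient Γ ℍ) = y ∧
            ((Ψ τ : ℂ) : ℂ ⧸ L.lattice.toAddSubgroup) = c} ≠ d} with hE
  -- the three null sets
  have hbad₁ : volume {w : ℂ | ((w : ℂ) : ℂ ⧸ L.lattice.toAddSubgroup) ∈ E} = 0 :=
    (countable_setOf_coe_mem hfin).measure_zero _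
  have hΨdiff : DifferentiableOn ℝ (Ψ ∘ ofComplex) {z : ℂ | 0 < z.im} :=
    (differentiableOn_segmentIntegral s τ₀).restrictScalars ℝ
  have hbad₂ : volume {w : ℂ | ∃ v ∈ Ψ '' {τ : ℍ | ¬ (τ ∈ F → ∀ γ ∈ Γ, γ • τ ∈ F →
      γ • τ = τ)}, v - w ∈ (L.lattice : Set ℂ)} = 0 := by
    refine volume_setOf_exists_sub_mem_eq_zero hΛc ?_
    have himg : Ψ '' {τ : ℍ | ¬ (τ ∈ F → ∀ γ ∈ Γ, γ • τ ∈ F → γ • τ = τ)} =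
        (Ψ ∘ ofComplex) '' (((↑) : ℍ → ℂ) ''
          {τ : ℍ | ¬ (τ ∈ F → ∀ γ ∈ Γ, γ • τ ∈ F → γ • τ = τ)}) := by
      rw [image_image]
      exact image_congr fun τ _ ↦ by simp [ofComplex_apply]
    rw [himg]
    refine addHaar_image_eq_zero_of_differentiableOn_of_addHaar_eq_zero volume
      (hΨdiff.mono ?_) (volume_image_coe_eq_zero (ae_iff.mp hF.ae_unique))
    rintro _ ⟨τ, -, rfl⟩
    exact τ.im_pos
  have hbad₃ : volume {w : ℂ | ∃ v ∈ Ψ '' {τ : ℍ | s τ = 0},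
      v - w ∈ (L.lattice : Set ℂ)} = 0 :=
    volume_setOf_exists_sub_mem_eq_zero hΛc
      (((countable_setOf_cuspForm_eq_zero s hs).image _).measure_zero _)
  filter_upwards [measure_eq_zero_iff_ae_notMem.mp hbad₁, measure_eq_zero_iff_ae_notMem.mp hbad₂,
    measure_eq_zero_iff_ae_notMem.mp hbad₃] with w hw₁ hw₂ hw₃
  have hdeg : Nat.card {y : MulAction.orbitRel.Quotient Γ ℍ // ∃ τ : ℍ,
      (Quotient.mk _ τ : MulAction.orbitRel.Quotient Γ ℍ) = y ∧
        Ψ τ - w ∈ L.lattice} = d := by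
    simp only [hE, mem_setOf_eq, not_not] at hw₁
    rw [← hw₁]
    refine Nat.card_congr (Equiv.subtypeEquivRight fun y ↦ ?_)
    refine exists_congr fun τ ↦ and_congr_right fun _ ↦ ?_
    rw [QuotientAddGroup.eq_iff_sub_mem, Submodule.mem_toAddSubgroup]
  have huniq : ∀ τ ∈ F, Ψ τ - w ∈ L.lattice → ∀ γ ∈ Γ, γ • τ ∈ F → γ • τ = τ := by
    intro τ hτF hτΛ γ hγ hγF
    by_contra hne
    exact hw₂ ⟨_, ⟨τ, fun h ↦ hne (h hτF γ hγ hγF), rfl⟩, hτΛ⟩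
  have hnz : ∀ τ : ℍ, Ψ τ - w ∈ L.lattice → s τ ≠ 0 := fun τ hτ hf ↦
    hw₃ ⟨_, ⟨τ, hf, rfl⟩, hτ⟩
  rw [← encard_fiber_inter_eq s τ₀ hF hper hd hdeg huniq, ← encard_iUnion_of_pairwise_disjoint]
  · have hset : (⋃ l : L.lattice, (Ψ ∘ ofComplex) ⁻¹' {(l : ℂ) + w} ∩
        ((↑) : ℍ → ℂ) '' (F ∩ {τ | s τ ≠ 0})) =
        ((↑) : ℍ → ℂ) '' {τ : ℍ | τ ∈ F ∧ Ψ τ - w ∈ L.lattice} := by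
      ext z
      simp only [mem_iUnion, mem_inter_iff, mem_preimage, mem_singleton_iff, Function.comp_apply]
      constructor
      · rintro ⟨l, hzl, τ, ⟨hτF, -⟩, rfl⟩
        refine ⟨τ, ⟨hτF, ?_⟩, rfl⟩
        rw [ofComplex_apply] at hzl
        rw [hzl, add_sub_cancel_right]
        exact l.2
      · rintro ⟨τ, ⟨hτF, hτΛ⟩, rfl⟩
        refine ⟨⟨Ψ τ - w, hτΛ⟩, ?_, τ, ⟨hτF, hnz τ hτΛ⟩, rfl⟩
        rw [ofComplex_apply, Submodule.coe_mk, sub_add_cancel]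
    rw [hset, coe_injective.encard_image]
  · intro l l' hll'
    simp only [Function.onFun]
    refine Set.disjoint_left.mpr fun z hz hz' ↦ hll' ?_
    have h1 : (Ψ ∘ ofComplex) z = (l : ℂ) + w := hz.1
    have h2 : (Ψ ∘ ofComplex) z = (l' : ℂ) + w := hz'.1
    exact Subtype.ext (add_right_cancel (h1.symm.trans h2))

end Counting

section Assembly

variable (s : CuspForm Γ 2) (τ₀ : ℍ) {L : PeriodPair} {F : Set ℍ}

/-- **Frey's identity in `ℝ≥0∞` for a period-lattice form with a degree**:
`∫⁻_F |s|² y² dμ = d · covol(Λ_L)` ((1) hyperbolic integral over `F` = Lebesgue integral of `|s|²`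
over `F ⊆ ℂ`; (1') the zero set of `s` does not contribute; (2) area formula with multiplicity;
(3) tiling `ℂ` by `Λ_L`, the periodised multiplicity being `d` a.e.). [folklore] -/
theorem lintegral_normSq_eq (hF : IsHypFundamentalDomain Γ F) (hs : (⇑s : ℍ → ℂ) ≠ 0)
    (hper : HasPeriodsIn Γ s (L.lattice : Set ℂ)) {d : ℕ} (hd : 0 < d)
    (hfin : {c : ℂ ⧸ L.lattice.toAddSubgroup |
        Nat.card {y : MulAction.orbitRel.Quotient Γ ℍ // ∃ τ : ℍ,
          (Quotient.mk _ τ : MulAction.orbitRel.Quotient Γ ℍ) = y ∧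
            ((segmentIntegral s τ₀ τ : ℂ) : ℂ ⧸ L.lattice.toAddSubgroup) = c} ≠ d}.Finite) :
    ∫⁻ τ in F, ENNReal.ofReal (‖s τ‖ ^ 2 * τ.im ^ 2) =
      d * ENNReal.ofReal (ZLattice.covolume L.lattice) := by
  classical
  haveI : Countable L.lattice := Countable.of_equiv _ L.latticeEquivProd.toEquiv.symm
  have hFm : MeasurableSet F := hF.measurableSet
  have hUm := measurableSet_image_inter s hF
  -- (1) the hyperbolic integral as a Lebesgue integral over `F ⊆ ℂ`
  rw [lintegral_domain_eq_lintegral_image hFm s]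
  -- (1') the zeros of `s` do not contribute
  have hB : ∫⁻ z in ((↑) : ℍ → ℂ) '' F, ENNReal.ofReal (‖s (ofComplex z)‖ ^ 2) =
      ∫⁻ z in ((↑) : ℍ → ℂ) '' (F ∩ {τ | s τ ≠ 0}),
        ENNReal.ofReal (‖s (ofComplex z)‖ ^ 2) := by
    symm
    have hsub : ((↑) : ℍ → ℂ) '' (F ∩ {τ | s τ ≠ 0}) ⊆ ((↑) : ℍ → ℂ) '' F :=
      image_mono inter_subset_left
    rw [← inter_eq_self_of_subset_left hsub, ← Measure.restrict_restrict hUm,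
      ← lintegral_indicator hUm]
    refine setLIntegral_congr_fun (measurableEmbedding_coe.measurableSet_image.mpr hFm) ?_
    rintro _ ⟨τ, hτ, rfl⟩
    dsimp only
    by_cases hf : s τ = 0
    · rw [indicator_of_notMem, ofComplex_apply, hf, norm_zero, zero_pow two_ne_zero,
        ENNReal.ofReal_zero]
      intro hmem
      exact ((coe_injective.mem_set_image).mp hmem).2 hf
    · rw [indicator_of_mem]
      exact ⟨τ, ⟨hτ, hf⟩, rfl⟩
  -- (2) area formula, (3) tiling
  rw [hB, lintegral_eq_lintegral_encard s τ₀ hF]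
  exact lintegral_eq_mul_covolume_of_tsum_eq L.lattice (measurable_encard_fiber s τ₀ hF)
    (ae_tsum_encard_fiber_eq s τ₀ hF hs hper hd hfin)

end Assembly

end Summit.BirchSwinnertonDyer.BirchSwinnertonDyer.Theorems.CartanCover.PeriodForm

end
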